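import Summits.QuantumFields.YangMills.Theorems.ColdStartUniversalityLindebergSwapTelescoping
import Summits.QuantumFields.YangMills.Theorems.ColdStartUniversalityLindebergSwapStepDownCompat
import HarnessLib

/-!
# Crux `ColdStartContinuumCauchy` (stmt-QuantumFields-24810, route `ColdStartUniversality`), LINE 3 «lindeberg_swap»:
# THE REDUCTION OF THE CRUX TO THE TWO LOAD-BEARING STUBS (kernel-checked state of the line)

With four of the six composition stubs of the registered skeleton (sha 5aa38edd) now landed BY NAME in the tree —
`stub_cesaroLawUnique`, `stub_loopStringLipschitz` (p665853), `stub_stepDownCompat` (`…LindebergSwapStepDownCompat`),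
`stub_lindebergTelescoping` (p683300) — the skeleton's sorry-free kernel `cauchy_of_geomIncrements` and its composition
`ColdStartContinuumCauchy_of` (both reproduced verbatim from the registered skeleton, where they are not importable) give the
importable, kernel-checked reduction

  `coldStartContinuumCauchy_of_oneWindowSwap_of_scalePropagation :
      __Registered.stub_oneWindowSwap → __Registered.stub_scalePropagation → Theses.ColdStartUniversality.ColdStartContinuumCauchy`.

CONDITIONAL on exactly the two XL stubs (the K_A2 body), which are NOT proved here; helper `--supports stmt-QuantumFields-24810`.
HONEST FRAMING: no crux, target or summit is proved; the Yang–Mills mass gap is NOT proved.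
-/

set_option autoImplicit false

namespace Summit.QuantumFields.YangMills.Cruxes.ColdStartContinuumCauchy.LindebergSwap

open scoped NNReal
open MeasureTheory
open Literature.MathematicalPhysics.QuantumFieldTheory
open Literature.MathematicalPhysics.QuantumFieldTheory.Balaban1983to89

/-- **KERNEL of LINE 3 (verbatim from the registered skeleton)**: geometric cut-off increments of the Cesàro values (any cold-start
solutions on any spaces) make every admissible sequence of the crux Cauchy. [folklore] -/
theorem cauchy_of_geomIncrements (hG : GeomIncrements) :
    Summit.QuantumFields.YangMills.Theses.ColdStartUniversality.ColdStartContinuumCauchy := by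
  intro F γ hγ os T hT a ha
  obtain ⟨C, r, hr0, hr1, hstep⟩ := hG F γ hγ os T hT
  refine cauchySeq_of_le_geometric r C hr1 fun K => ?_
  obtain ⟨Ω', mΩ', P', hP', W', hW', U', hU'0, hU'sol, haK1⟩ := ha (K + 1)
  obtain ⟨Ω, mΩ, P, hP, W, hW, U, hU0, hUsol, haK⟩ := ha K
  have eK1 : a (K + 1) = cesaro F (K + 1) os T P' U' := haK1
  have eK : a K = cesaro F K os T P U := haK
  rw [Real.dist_eq, eK, eK1, abs_sub_comm]
  exact hstep K Ω' mΩ' P' hP' W' hW' U' ⟨hU'0, hU'sol⟩ Ω mΩ P hP W hW U ⟨hU0, hUsol⟩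

/-- **COMPOSITION of LINE 3 (verbatim from the registered skeleton)**: the five nodes feed the telescoping node, whose output is the
geometric-increment statement; the kernel concludes the crux BY NAME. [folklore] -/
theorem ColdStartContinuumCauchy_of (h1 : __Registered.stub_cesaroLawUnique) (h2 : __Registered.stub_stepDownCompat)
    (h3 : __Registered.stub_oneWindowSwap) (h4 : __Registered.stub_scalePropagation)
    (h5 : __Registered.stub_loopStringLipschitz) (h6 : __Registered.stub_lindebergTelescoping) :
    Summit.QuantumFields.YangMills.Theses.ColdStartUniversality.ColdStartContinuumCauchy :=
  cauchy_of_geomIncrements (h6 h1 h2 h3 h4 h5)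

/-- ★ **THE STATE OF LINE 3, KERNEL-CHECKED**: the crux `ColdStartContinuumCauchy` (K_A2 of route `ColdStartUniversality`) follows from
the two load-bearing registered stubs `stub_oneWindowSwap` (one-window weak commutator, geometric in `K`) and `stub_scalePropagation`
(K-uniform propagation of the scale-weighted class) ALONE — the other four composition stubs are landed theorems of the tree.
CONDITIONAL on those two XL stubs; nothing here proves them. [folklore] -/
theorem coldStartContinuumCauchy_of_oneWindowSwap_of_scalePropagation
    (h3 : __Registered.stub_oneWindowSwap) (h4 : __Registered.stub_scalePropagation) :
    Summit.QuantumFields.YangMills.Theses.ColdStartUniversality.ColdStartContinuumCauchy :=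
  ColdStartContinuumCauchy_of stub_cesaroLawUnique stub_stepDownCompat h3 h4 stub_loopStringLipschitz stub_lindebergTelescoping

end Summit.QuantumFields.YangMills.Cruxes.ColdStartContinuumCauchy.LindebergSwap
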